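import Mathlib

/-!
# A2GaloisDescent — the rational points of a base-changed vector space

Kernel annex of sub-claim A2 (seat p6, cell pub-hodge-repro2), the base-change set-up of
Prop. A8.1 Step 3 and of Lemma A4.2.2 (ii) that `LEAN-ANNEX-p6.md` §3 lists as not formalised:
«`H²(A_a × A_b, F₁) = H²(·, ℚ) ⊗ F₁` with its semilinear Galois action, and the
`Gal(F₁/ℚ)`-invariants are the rational classes».

Statement (finite Galois extension `L/K`, `V` any `K`-vector space): the group `Gal(L/K)` acts on
`L ⊗[K] V` through the first factor, `σ ⊗ id`, and an element fixed by every `σ` is of the form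
`1 ⊗ v` with `v ∈ V`.  Proof: expand in the `L`-basis `1 ⊗ b_i` induced by a `K`-basis `b_i` of
`V` (Mathlib `Algebra.TensorProduct.basis`); `σ ⊗ id` acts on the coordinates by `σ`; a coordinate
fixed by every `σ` lies in `K` (Mathlib `mem_range_algebraMap_iff_fixed`, i.e.
`fixedField ⊤ = ⊥`); then `Σ c_i ⊗ b_i = 1 ⊗ Σ k_i b_i`.

In the section: `K = ℚ`, `L = F₁` a Galois number field, `V = H²(A_a × A_b, ℚ)`.
Only linear algebra and the Galois correspondence; no geometry.
-/

namespace Summit.Ventures.HodgeRepro2.A2GaloisDescent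

open TensorProduct

variable {K L : Type*} [Field K] [Field L] [Algebra K L]
  {V : Type*} [AddCommGroup V] [Module K V]

/-- The coefficient action `σ ⊗ id` on a pure tensor. -/
theorem rTensor_tmul (σ : L ≃ₐ[K] L) (c : L) (v : V) :
    LinearMap.rTensor V σ.toLinearMap (c ⊗ₜ[K] v) = σ c ⊗ₜ[K] v :=
  LinearMap.rTensor_tmul _ _ _ _

/-- A rational vector `1 ⊗ v` is fixed by the coefficient action. -/
theorem rTensor_one_tmul (σ : L ≃ₐ[K] L) (v : V) :
    LinearMap.rTensor V σ.toLinearMap ((1 : L) ⊗ₜ[K] v) = (1 : L) ⊗ₜ[K] v := by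
  rw [rTensor_tmul, map_one]

/-- In the `L`-basis `1 ⊗ b i` of `L ⊗[K] V` induced by a `K`-basis `b` of `V`, the coefficient
action `σ ⊗ id` acts on the coordinates by `σ`. -/
theorem repr_rTensor {ι : Type*} (b : Module.Basis ι K V) (σ : L ≃ₐ[K] L) (x : L ⊗[K] V) (i : ι) :
    (Algebra.TensorProduct.basis L b).repr (LinearMap.rTensor V σ.toLinearMap x) i =
      σ ((Algebra.TensorProduct.basis L b).repr x i) := by
  induction x using TensorProduct.induction_on with
  | zero => simp
  | tmul c v =>
    simp only [rTensor_tmul, Algebra.TensorProduct.basis_repr_tmul, Finsupp.smul_apply,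
      Finsupp.mapRange_apply, smul_eq_mul, map_mul, AlgEquiv.commutes]
  | add x y hx hy =>
    simp only [map_add, Finsupp.add_apply, hx, hy]

/-- **Galois descent for vectors.** For a finite Galois extension `L/K`, an element of
`L ⊗[K] V` fixed by every `σ ⊗ id`, `σ ∈ Gal(L/K)`, is rational: it equals `1 ⊗ v` for some
`v ∈ V`. -/
theorem exists_one_tmul_eq_of_forall_rTensor_eq [IsGalois K L] [FiniteDimensional K L]
    (x : L ⊗[K] V) (hx : ∀ σ : L ≃ₐ[K] L, LinearMap.rTensor V σ.toLinearMap x = x) :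
    ∃ v : V, (1 : L) ⊗ₜ[K] v = x := by
  classical
  have hfix : ∀ i, ∀ σ : L ≃ₐ[K] L,
      σ ((Algebra.TensorProduct.basis L (Module.Basis.ofVectorSpace K V)).repr x i) =
        (Algebra.TensorProduct.basis L (Module.Basis.ofVectorSpace K V)).repr x i := by
    intro i σ
    have h := repr_rTensor (Module.Basis.ofVectorSpace K V) σ x i
    rw [hx σ] at h
    exact h.symm
  have hmem : ∀ i, (Algebra.TensorProduct.basis L (Module.Basis.ofVectorSpace K V)).repr x i ∈
      Set.range (algebraMap K L) := fun i =>
    (IsGalois.mem_range_algebraMap_iff_fixed _).mpr (hfix i)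
  choose k hk using hmem
  refine ⟨∑ i ∈ ((Algebra.TensorProduct.basis L (Module.Basis.ofVectorSpace K V)).repr x).support,
    k i • Module.Basis.ofVectorSpace K V i, ?_⟩
  rw [TensorProduct.tmul_sum]
  conv_rhs =>
    rw [← (Algebra.TensorProduct.basis L (Module.Basis.ofVectorSpace K V)).linearCombination_repr x,
      Finsupp.linearCombination_apply, Finsupp.sum]
  refine Finset.sum_congr rfl fun i _ => ?_
  rw [Algebra.TensorProduct.basis_repr_symm_apply', ← hk i, Algebra.algebraMap_eq_smul_one,
    TensorProduct.smul_tmul]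

/-- The fixed vectors of the coefficient action form exactly the rational subspace: as
`K`-submodules of `L ⊗[K] V`, `⋂_σ ker (σ ⊗ id − id) = range (v ↦ 1 ⊗ v)`. -/
theorem iInf_ker_rTensor_sub_id_eq_range [IsGalois K L] [FiniteDimensional K L] :
    (⨅ σ : L ≃ₐ[K] L, LinearMap.ker (LinearMap.rTensor V σ.toLinearMap - LinearMap.id)) =
      LinearMap.range (TensorProduct.mk K L V 1) := by
  ext x
  simp only [Submodule.mem_iInf, LinearMap.mem_ker, LinearMap.sub_apply, LinearMap.id_apply,
    sub_eq_zero, LinearMap.mem_range, TensorProduct.mk_apply]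
  constructor
  · exact exists_one_tmul_eq_of_forall_rTensor_eq x
  · rintro ⟨v, rfl⟩ σ
    exact rTensor_one_tmul σ v

/-- The rational form: a vector of `L ⊗[K] V` is fixed by every `σ ⊗ id` iff it is `1 ⊗ v` for
some `v`. -/
theorem forall_rTensor_eq_iff_exists_one_tmul_eq [IsGalois K L] [FiniteDimensional K L]
    (x : L ⊗[K] V) :
    (∀ σ : L ≃ₐ[K] L, LinearMap.rTensor V σ.toLinearMap x = x) ↔ ∃ v : V, (1 : L) ⊗ₜ[K] v = x :=
  ⟨exists_one_tmul_eq_of_forall_rTensor_eq x, fun ⟨v, hv⟩ σ => hv ▸ rTensor_one_tmul σ v⟩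

/-- The rational vector of a fixed element is unique (`v ↦ 1 ⊗ v` is injective; a field
extension is faithfully flat, Mathlib `Module.Flat.tensorProduct_mk_injective`). -/
theorem one_tmul_injective : Function.Injective fun v : V => (1 : L) ⊗ₜ[K] v :=
  Module.Flat.tensorProduct_mk_injective K V L

/-- Uniqueness of the rational form: `1 ⊗ v = 1 ⊗ w` forces `v = w`. -/
theorem eq_of_one_tmul_eq {v w : V} (h : (1 : L) ⊗ₜ[K] v = (1 : L) ⊗ₜ[K] w) : v = w :=
  one_tmul_injective h

end Summit.Ventures.HodgeRepro2.A2GaloisDescent
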